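import Literature.Computability.QuantumComplexity.GenericStabilizerRankSpan
import Literature.Computability.QuantumComplexity.GenericStabilizerRankProofs
import HarnessLib

/-!
# Lovitz–Steffan 2022, Prop. 5.5 in stabilizer-cover form — discharge

Discharge of the named fact
`Literature.Computability.QuantumComplexity.LovitzSteffan2022_stabilizerCover_of_distinctPowers`
(`GenericStabilizerRankSpan.lean`): if `n+1` nonzero, pairwise non-proportional qubit vectors
`ψ₀,…,ψ_n` have `χ(ψᵢ^{⊗n}) ≤ r`, then ONE family of at most `r(n+1)` stabilizer states spans every
`ψ^{⊗n}`.  This is the printed proof of Prop. 5.5, whose two ingredients are in the tree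
(`GenericStabilizerRankProofs.lean`): padded stabilizer decompositions of the `ψᵢ^{⊗n}`
(`exists_stabilizerCover_of_rank_le`) and the projective-Vandermonde span lemma
(`tensorPow_mem_span_of_pairwise_linearIndependent`: `n+1` pairwise independent `n`-th tensor
powers span all of them).  "Nonzero and pairwise non-proportional" is converted to pairwise linear
independence (`LinearIndependent.pair_iff`).

## References
* [LovitzSteffan2022] B. Lovitz, V. Steffan, *New techniques for bounding stabilizer rank*,
  Quantum 6 (2022) 692, arXiv:2110.07781, Prop. 5.5 (p. 14, with its proof) and Prop. 5.3.
-/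

noncomputable section

namespace Literature.Computability.QuantumComplexity

open Cryptography

/-- Nonzero and non-proportional vectors are linearly independent as a pair. [folklore] -/
private theorem LS22.linearIndependent_pair_of_ne {V : Type*} [AddCommGroup V] [Module ℂ V]
    {x y : V} (hy : y ≠ 0) (hxy : ∀ c : ℂ, x ≠ c • y) :
    LinearIndependent ℂ ![x, y] := by
  rw [LinearIndependent.pair_iff]
  intro s t hst
  by_cases hs : s = 0
  · subst hs
    simp only [zero_smul, zero_add, smul_eq_zero] at hst
    exact ⟨rfl, hst.resolve_right hy⟩
  · exfalso
    refine hxy (-(t / s)) ?_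
    have : x = -(s⁻¹ • (t • y)) := by
      have h1 : s • x = -(t • y) := eq_neg_of_add_eq_zero_left hst
      calc x = s⁻¹ • (s • x) := by rw [smul_smul, inv_mul_cancel₀ hs, one_smul]
        _ = -(s⁻¹ • (t • y)) := by rw [h1, smul_neg]
    rw [this, smul_smul, ← neg_smul, div_eq_inv_mul]

/-- **Lovitz–Steffan 2022, Prop. 5.5 (stabilizer-cover form) — the named fact
`LovitzSteffan2022_stabilizerCover_of_distinctPowers` holds.** The union of padded stabilizer
decompositions (`r` states each) of the `n+1` cheap powers `ψᵢ^{⊗n}` is a family of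
`(n+1)·r` stabilizer states whose span contains `span{ψᵢ^{⊗n}}`, which contains every `ψ^{⊗n}`
by the projective Vandermonde lemma. [cite: LovitzSteffan2022, Prop. 5.5 (p. 14, with its proof) and Prop. 5.3 (p. 13)] -/
theorem LovitzSteffan2022_stabilizerCover_of_distinctPowers_holds :
    LovitzSteffan2022_stabilizerCover_of_distinctPowers := by
  intro n r ψs hne hprop hrank
  classical
  -- pairwise linear independence
  have hind : ∀ i j, i ≠ j → LinearIndependent ℂ ![ψs i, ψs j] :=
    fun i j hij => LS22.linearIndependent_pair_of_ne (hne j) (hprop i j hij)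
  -- padded stabilizer decompositions, `r` states for each `i`
  choose τ hτ hmem using fun i => exists_stabilizerCover_of_rank_le (tensorPow (ψs i) n) (hrank i)
  -- the union, indexed by `Fin ((n+1) * r)`
  refine ⟨(n + 1) * r, fun k => τ (finProdFinEquiv.symm k).1 (finProdFinEquiv.symm k).2,
    le_of_eq (Nat.mul_comm _ _), fun k => hτ _ _, fun ψ => ?_⟩
  refine (Submodule.span_le.2 ?_) (tensorPow_mem_span_of_pairwise_linearIndependent ψs hind ψ)
  rintro _ ⟨i, rfl⟩
  refine (Submodule.span_mono ?_) (hmem i)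
  rintro _ ⟨j, rfl⟩
  refine ⟨finProdFinEquiv (i, j), ?_⟩
  simp only [Equiv.symm_apply_apply]

end Literature.Computability.QuantumComplexity

end
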